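import Summits.AtomisticToContinuum.FouriersLaw.Theorems.EmbeddedDrudeMourreFGRGapEssGapF
import Literature.MathematicalPhysics.KineticTheory.DiPernaLionsExpDuhamel

/-!
# `FGRGap`, line fold-jet-rigidity, stub `stub_oddEssentialGap` — part G: the local estimate

Helper file for the crux `Summit.AtomisticToContinuum.FouriersLaw.Theses.EmbeddedDrudeMourre.FGRGap`
(item `stmt-AtomisticToContinuum-12595`), registered stub `stub_oddEssentialGap` (sequel of parts A–F).

`local_estimate`: given the partner map `h` (GA clauses) and fibre genericity (GB clause), `a > 0`,
`b ≥ 0`, and a base momentum `x₀`, there are `ε > 0`, `c > 0` and an error functional `X` with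
`¼ · ofReal (c ∫_{[x₀-ε,x₀+ε]} g² + X g) ≤ q(g)` for every `2π`-periodic measurable `g` with
`‖g‖²_{cell} ≤ 1`, and `X(g_n) → 0` along weakly-null sequences. Proof: on the good rectangle `R` of
part F, `T = w·(g₁+g₂-g₃-g₄)² ≥ S = W g₁² + 2W g₁(g₂-g₃-g₄)` pointwise; `∫_R S = ∫_R W g₁² + X g`,
`∫_R W g₁² ≥ w₀ (2ε) ∫ g²`; `¼∫⁻_R T ≤ q` (part C); the three cross terms in `X` are chart integrals
(parts D, E) and die along weakly-null sequences (part B). Folklore; no named facts.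
-/

noncomputable section

open MeasureTheory Set Real Filter Topology
open scoped ENNReal
open Literature.MathematicalPhysics.KineticTheory.PhononBoltzmann

namespace Summit.AtomisticToContinuum.FouriersLaw.Theorems.FGRGap.FoldJetRigidity.EssGap

/-- The lower-triangular derivative matrix `[1 0; α β]` of a coordinate-pair chart, as a continuous linear
map of `ℝ × ℝ`. -/
local notation3 "chartCLM[" α ", " β "]" =>
  LinearMap.toContinuousLinearMap (Matrix.toLin (Module.Basis.finTwoProd ℝ) (Module.Basis.finTwoProd ℝ)
    !![(1 : ℝ), 0; α, β])

/-- `∫_{[y₀-ε, y₀+ε]} 1 = 2ε`. [folklore] -/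
theorem setIntegral_one_Icc {y₀ ε : ℝ} (hε : 0 ≤ ε) : ∫ _ in Icc (y₀ - ε) (y₀ + ε), (1 : ℝ) = 2 * ε := by
  rw [setIntegral_const, smul_eq_mul, mul_one, measureReal_def, Real.volume_Icc,
    ENNReal.toReal_ofReal (by linarith)]
  ring

/-- **The local estimate at a base point.** [folklore] -/
theorem local_estimate {ω₂ : ℝ} (hω : 0 < ω₂) {h : ℝ → ℝ → ℝ}
    (hres : ∀ k₁ k₃ : ℝ, resonanceFn ω₂ k₁ (h k₁ k₃) k₃ = 0)
    (hper : ∀ k₁ k₃ : ℝ, h (k₁ + 2 * π) k₃ = h k₁ k₃ ∧ h k₁ (k₃ + 2 * π) = h k₁ k₃)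
    (htwo : ∀ k₁ k₃ : ℝ, (∀ n : ℤ, k₃ - k₁ ≠ n * (2 * π)) →
      resonantSet ω₂ k₁ k₃ = {toIocMod Real.two_pi_pos (-π) k₃, h k₁ k₃})
    (hloc : ∀ k₁ k₃ : ℝ, groupVelocity ω₂ k₃ ≠ groupVelocity ω₂ k₁ →
      ∃ (φ : ℝ × ℝ → ℝ) (U : Set (ℝ × ℝ)), U ∈ 𝓝 (k₁, k₃) ∧ AnalyticOnNhd ℝ φ U ∧
        φ (k₁, k₃) = h k₁ k₃ ∧ (∀ p ∈ U, ∃ n : ℤ, φ p = h p.1 p.2 + n * (2 * π)) ∧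
        (∀ p ∈ U, groupVelocity ω₂ p.2 ≠ groupVelocity ω₂ p.1) ∧
        (∀ p ∈ U, HasStrictFDerivAt φ
          (((groupVelocity ω₂ (p.1 + φ p - p.2) - groupVelocity ω₂ p.1) /
              (groupVelocity ω₂ (φ p) - groupVelocity ω₂ (p.1 + φ p - p.2))) •
              ContinuousLinearMap.fst ℝ ℝ ℝ +
            ((groupVelocity ω₂ p.2 - groupVelocity ω₂ (p.1 + φ p - p.2)) /
              (groupVelocity ω₂ (φ p) - groupVelocity ω₂ (p.1 + φ p - p.2))) •
              ContinuousLinearMap.snd ℝ ℝ ℝ) p))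
    (hgp : ∀ k₁ r : ℝ, 0 ≤ r → ∃ k₃ : ℝ,
      (groupVelocity ω₂ k₁ ≠ groupVelocity ω₂ (h k₁ k₃) ∧ groupVelocity ω₂ k₁ ≠ groupVelocity ω₂ k₃ ∧
        groupVelocity ω₂ k₁ ≠ groupVelocity ω₂ (k₁ + h k₁ k₃ - k₃) ∧
          groupVelocity ω₂ (h k₁ k₃) ≠ groupVelocity ω₂ k₃ ∧
        groupVelocity ω₂ (h k₁ k₃) ≠ groupVelocity ω₂ (k₁ + h k₁ k₃ - k₃) ∧
          groupVelocity ω₂ k₃ ≠ groupVelocity ω₂ (k₁ + h k₁ k₃ - k₃)) ∧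
      vertex 1 r k₁ (h k₁ k₃) k₃ ≠ 0)
    {a b : ℝ} (ha : 0 < a) (hb : 0 ≤ b) (x₀ : ℝ) :
    ∃ ε : ℝ, 0 < ε ∧ ∃ c : ℝ, 0 < c ∧ ∃ X : (ℝ → ℝ) → ℝ,
      (∀ g : ℝ → ℝ, Function.Periodic g (2 * π) → Measurable g → cellNormSq g ≤ 1 →
        ENNReal.ofReal (1 / 4) * ENNReal.ofReal (c * (∫ x in Icc (x₀ - ε) (x₀ + ε), g x ^ 2) + X g) ≤
          boltzmannForm ω₂ a b g) ∧
      (∀ g : ℕ → ℝ → ℝ, (∀ n, Function.Periodic (g n) (2 * π)) → (∀ n, Measurable (g n)) →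
        (∀ n, cellNormSq (g n) ≤ 1) →
        (∀ φ : ℝ → ℝ, Measurable φ → cellNormSq φ < ∞ →
          Tendsto (fun n => cellPairing φ (g n)) atTop (𝓝 0)) →
        Tendsto (fun n => X (g n)) atTop (𝓝 0)) := by
  obtain ⟨ε, y₀, φ, c₃, e₂, e₄, w₀, δ, N, R, hRdef, hε, hε1, hw₀, hδ, hmod, hc₃, hder, hφc, hc₃c, he₂, he₄,
    hR2, hR4, hδ2, hδ4, hWb, hWc, hRwin, h2win, h4win⟩ := exists_good_rectangle hω hloc hgp ha hb x₀
  set v := groupVelocity ω₂ with hv_def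
  set W : ℝ × ℝ → ℝ := fun p => collisionWeight ω₂ a b p.1 (φ p) p.2 with hW
  set κ : ℝ × ℝ → ℝ := fun p => p.1 + φ p - p.2 with hκ
  set c₁ : ℝ × ℝ → ℝ := fun p => (v (κ p) - v p.1) / (v (φ p) - v (κ p)) with hc₁
  -- basic facts on `R`
  have hRc : IsCompact R := by rw [hRdef]; exact isCompact_Icc.prod isCompact_Icc
  have hRm : MeasurableSet R := hRc.isClosed.measurableSet
  have hWnn : ∀ p ∈ R, |W p| ≤ 4 * w₀ := fun p hp => by
    rw [abs_of_nonneg (hw₀.le.trans (hWb p hp).1)]; exact (hWb p hp).2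
  have hκc : ContinuousOn κ R := (continuousOn_fst.add hφc).sub continuousOn_snd
  -- chart data: `e₂`
  have hderiv2 : ∀ p ∈ R, HasFDerivWithinAt e₂ (chartCLM[c₁ p, c₃ p]) R p := by
    intro p hp
    have e : (e₂ : ℝ × ℝ → ℝ × ℝ) = fun q => (q.1, φ q) := funext he₂
    rw [e]
    exact (hasStrictFDerivAt_chart2 (hder p hp)).hasFDerivAt.hasFDerivWithinAt
  have hdet2 : ∀ p ∈ R, δ ≤ |(chartCLM[c₁ p, c₃ p]).det| := fun p hp => by
    rw [chartCLM_det]; exact hδ2 p hp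
  have hDc2 : ContinuousOn (fun p => (chartCLM[c₁ p, c₃ p]).det) R := by
    simp_rw [chartCLM_det]; exact hc₃c
  -- chart data: `e₄`
  have hderiv4 : ∀ p ∈ R, HasFDerivWithinAt e₄ (chartCLM[1 + c₁ p, c₃ p - 1]) R p := by
    intro p hp
    have e : (e₄ : ℝ × ℝ → ℝ × ℝ) = fun q => (q.1, q.1 + φ q - q.2) := funext he₄
    rw [e]
    exact (hasStrictFDerivAt_chart4 (hder p hp)).hasFDerivAt.hasFDerivWithinAt
  have hdet4 : ∀ p ∈ R, δ ≤ |(chartCLM[1 + c₁ p, c₃ p - 1]).det| := fun p hp => by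
    rw [chartCLM_det]; exact hδ4 p hp
  have hDc4 : ContinuousOn (fun p => (chartCLM[1 + c₁ p, c₃ p - 1]).det) R := by
    simp_rw [chartCLM_det]; exact hc₃c.sub continuousOn_const
  -- chart data: the identity
  set e₀ : OpenPartialHomeomorph (ℝ × ℝ) (ℝ × ℝ) := OpenPartialHomeomorph.refl (ℝ × ℝ) with he₀
  have he₀' : ∀ p, e₀ p = p := fun p => rfl
  have hR0 : R ⊆ e₀.source := fun p _ => by rw [he₀]; exact mem_univ _
  have hderiv0 : ∀ p ∈ R, HasFDerivWithinAt e₀ (ContinuousLinearMap.id ℝ (ℝ × ℝ)) R p :=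
    fun p _ => (hasFDerivAt_id p).hasFDerivWithinAt
  have hdet0 : ∀ p ∈ R, (1 : ℝ) ≤ |(ContinuousLinearMap.id ℝ (ℝ × ℝ)).det| := fun p _ => by
    rw [ContinuousLinearMap.det, ContinuousLinearMap.coe_id, LinearMap.det_id, abs_one]
  have hDc0 : ContinuousOn (fun _ : ℝ × ℝ => (ContinuousLinearMap.id ℝ (ℝ × ℝ)).det) R :=
    continuousOn_const
  have h0win : e₀ '' R ⊆ Ioc (-π - N * (2 * π)) (π + N * (2 * π)) ×ˢ Ioc (-π - N * (2 * π)) (π + N * (2 * π)) := by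
    rw [show (e₀ : ℝ × ℝ → ℝ × ℝ) = id from funext he₀', image_id]; exact hRwin
  -- the error functional
  refine ⟨ε, hε, 2 * ε * w₀, by positivity, fun g => 2 * ((∫ p in R, W p * (g p.1 * g (φ p))) -
    (∫ p in R, W p * (g p.1 * g p.2)) - (∫ p in R, W p * (g p.1 * g (κ p)))), ?_, ?_⟩
  · -- (i) the lower bound
    intro g hg hgm hg1
    -- `L²` facts on `R`
    have hu1 : AEStronglyMeasurable (fun p : ℝ × ℝ => g p.1) (volume.restrict R) :=
      (hgm.comp measurable_fst).aestronglyMeasurable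
    have hu2 : AEStronglyMeasurable (fun p : ℝ × ℝ => g (φ p)) (volume.restrict R) :=
      (hgm.comp_aemeasurable (hφc.aemeasurable hRm)).aestronglyMeasurable
    have hu3 : AEStronglyMeasurable (fun p : ℝ × ℝ => g p.2) (volume.restrict R) :=
      (hgm.comp measurable_snd).aestronglyMeasurable
    have hu4 : AEStronglyMeasurable (fun p : ℝ × ℝ => g (κ p)) (volume.restrict R) :=
      (hgm.comp_aemeasurable (hκc.aemeasurable hRm)).aestronglyMeasurable
    have hWm : AEStronglyMeasurable W (volume.restrict R) := hWc.aestronglyMeasurable hRm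
    have hfin : ∀ {q : ℝ≥0∞} {d : ℝ}, 0 < d → q ≤ (ENNReal.ofReal d)⁻¹ *
        (ENNReal.ofReal ((2 * N + 1) * (2 * π)) * (2 * N + 1)) → q ≠ ∞ := by
      intro q d hd hq
      refine (lt_of_le_of_lt hq (ENNReal.mul_lt_top ?_ (ENNReal.mul_lt_top ENNReal.ofReal_lt_top ?_))).ne
      · exact ENNReal.inv_lt_top.mpr (ENNReal.ofReal_pos.mpr hd)
      · exact ENNReal.add_lt_top.2 ⟨ENNReal.mul_lt_top (by simp) (by simp), ENNReal.one_lt_top⟩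
    have h1fin : ∫⁻ p in R, ENNReal.ofReal (g p.1 ^ 2) ≠ ∞ :=
      hfin one_pos (lintegral_chart_sq_fst_le hRm hR0 hderiv0 one_pos hdet0 N h0win hg hg1)
    have h2fin : ∫⁻ p in R, ENNReal.ofReal (g (φ p) ^ 2) ≠ ∞ := by
      have := lintegral_chart_sq_snd_le hRm hR2 hderiv2 hδ hdet2 N h2win hg hg1
      simp_rw [he₂] at this
      exact hfin hδ this
    have h3fin : ∫⁻ p in R, ENNReal.ofReal (g p.2 ^ 2) ≠ ∞ :=
      hfin one_pos (lintegral_chart_sq_snd_le hRm hR0 hderiv0 one_pos hdet0 N h0win hg hg1)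
    have h4fin : ∫⁻ p in R, ENNReal.ofReal (g (κ p) ^ 2) ≠ ∞ := by
      have := lintegral_chart_sq_snd_le hRm hR4 hderiv4 hδ hdet4 N h4win hg hg1
      simp_rw [he₄] at this
      exact hfin hδ this
    have I1 := integrable_weight_mul_mul hRm hWm hWnn hu1 hu1 h1fin h1fin
    have I2 := integrable_weight_mul_mul hRm hWm hWnn hu1 hu2 h1fin h2fin
    have I3 := integrable_weight_mul_mul hRm hWm hWnn hu1 hu3 h1fin h3fin
    have I4 := integrable_weight_mul_mul hRm hWm hWnn hu1 hu4 h1fin h4fin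
    -- the single-term integrand `T` and its lower bound `S`
    set T : ℝ × ℝ → ℝ := fun p => collisionWeight ω₂ a b p.1 (h p.1 p.2) p.2 *
      (g p.1 + g (h p.1 p.2) - g p.2 - g (p.1 + h p.1 p.2 - p.2)) ^ 2 with hT
    set S : ℝ × ℝ → ℝ := fun p => W p * (g p.1 * g p.1) + 2 * (W p * (g p.1 * g (φ p))) -
      2 * (W p * (g p.1 * g p.2)) - 2 * (W p * (g p.1 * g (κ p))) with hS
    have hST : ∀ p ∈ R, S p ≤ T p := by
      intro p hp
      obtain ⟨n, hn⟩ := hmod p hp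
      have e1 : g (φ p) = g (h p.1 p.2) := by rw [hn]; exact hg.int_mul n _
      have e2 : g (κ p) = g (p.1 + h p.1 p.2 - p.2) := by
        simp only [hκ]
        rw [hn, show p.1 + (h p.1 p.2 + n * (2 * π)) - p.2 = p.1 + h p.1 p.2 - p.2 + n * (2 * π) by ring]
        exact hg.int_mul n _
      have e3 : W p = collisionWeight ω₂ a b p.1 (h p.1 p.2) p.2 := by
        simp only [hW]; rw [hn]; exact collisionWeight_add_int_mul_k2 ω₂ a b p.1 (h p.1 p.2) p.2 n
      have hW0 : 0 ≤ W p := hw₀.le.trans (hWb p hp).1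
      simp only [hS, hT]
      rw [← e3, ← e1, ← e2]
      nlinarith [mul_nonneg hW0 (sq_nonneg (g (φ p) - g p.2 - g (κ p)))]
    -- `∫ S = ∫ W g₁² + X g`
    have hSint : ∫ p in R, S p = (∫ p in R, W p * (g p.1 * g p.1)) +
        2 * ((∫ p in R, W p * (g p.1 * g (φ p))) - (∫ p in R, W p * (g p.1 * g p.2)) -
          (∫ p in R, W p * (g p.1 * g (κ p)))) := by
      have J2 : Integrable (fun p => 2 * (W p * (g p.1 * g (φ p)))) (volume.restrict R) := I2.const_mul 2
      have J3 : Integrable (fun p => 2 * (W p * (g p.1 * g p.2))) (volume.restrict R) := I3.const_mul 2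
      have J4 : Integrable (fun p => 2 * (W p * (g p.1 * g (κ p)))) (volume.restrict R) := I4.const_mul 2
      have J12 : Integrable (fun p => W p * (g p.1 * g p.1) + 2 * (W p * (g p.1 * g (φ p))))
          (volume.restrict R) := I1.add J2
      have J123 : Integrable (fun p => W p * (g p.1 * g p.1) + 2 * (W p * (g p.1 * g (φ p))) -
          2 * (W p * (g p.1 * g p.2))) (volume.restrict R) := J12.sub J3
      simp only [hS]
      rw [integral_sub J123 J4, integral_sub J12 J3, integral_add I1 J2,
        integral_const_mul, integral_const_mul, integral_const_mul]
      ring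
    -- `∫ W g₁² ≥ w₀ (2ε) ∫ g²`
    have hdiag : 2 * ε * w₀ * ∫ x in Icc (x₀ - ε) (x₀ + ε), g x ^ 2 ≤ ∫ p in R, W p * (g p.1 * g p.1) := by
      have hprod : ∫ p in R, g p.1 ^ 2 = (∫ x in Icc (x₀ - ε) (x₀ + ε), g x ^ 2) * (2 * ε) := by
        rw [hRdef, Measure.volume_eq_prod, ← setIntegral_one_Icc (y₀ := y₀) hε.le,
          ← setIntegral_prod_mul (fun x => g x ^ 2) (fun _ => (1 : ℝ))]
        simp
      have hg2 : IntegrableOn (fun p : ℝ × ℝ => g p.1 ^ 2) R :=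
        (lintegral_ofReal_ne_top_iff_integrable (hu1.pow 2) (Eventually.of_forall fun p => sq_nonneg _)).1 h1fin
      calc 2 * ε * w₀ * ∫ x in Icc (x₀ - ε) (x₀ + ε), g x ^ 2 = ∫ p in R, w₀ * g p.1 ^ 2 := by
            rw [integral_const_mul, hprod]; ring
        _ ≤ ∫ p in R, W p * (g p.1 * g p.1) := by
            refine setIntegral_mono_on (hg2.const_mul w₀) I1 hRm fun p hp => ?_
            rw [← sq]
            exact mul_le_mul_of_nonneg_right (hWb p hp).1 (sq_nonneg _)
    -- combine
    have hαβ : x₀ + ε - (x₀ - ε) < 2 * π := by linarith [Real.pi_gt_three]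
    have hγδ : y₀ + ε - (y₀ - ε) < 2 * π := by linarith [Real.pi_gt_three]
    have hLB := setLIntegral_rect_le hres hper htwo a b hg hαβ hγδ
    rw [← hRdef, ← Measure.volume_eq_prod] at hLB
    refine le_trans ?_ hLB
    refine mul_le_mul' le_rfl ?_
    calc ENNReal.ofReal (2 * ε * w₀ * (∫ x in Icc (x₀ - ε) (x₀ + ε), g x ^ 2) +
            2 * ((∫ p in R, W p * (g p.1 * g (φ p))) - (∫ p in R, W p * (g p.1 * g p.2)) -
              (∫ p in R, W p * (g p.1 * g (κ p)))))
        ≤ ENNReal.ofReal (∫ p in R, S p) := by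
          apply ENNReal.ofReal_le_ofReal; rw [hSint]; linarith
      _ ≤ ∫⁻ p in R, ENNReal.ofReal (S p) :=
          Literature.MathematicalPhysics.KineticTheory.ofReal_integral_le_lintegral S
      _ ≤ ∫⁻ p in R, ENNReal.ofReal (T p) :=
          setLIntegral_mono' hRm fun p hp => ENNReal.ofReal_le_ofReal (hST p hp)
  · -- (ii) the cross terms die along weakly-null sequences
    intro g hgp' hgm hg1 hweak
    have T2 := tendsto_setIntegral_chart hRc hRm hR2 hderiv2 hδ hdet2 hDc2 hWc (by positivity) hWnn N
      h2win hgp' hgm hg1 hweak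
    have T0 := tendsto_setIntegral_chart hRc hRm hR0 hderiv0 one_pos hdet0 hDc0 hWc (by positivity) hWnn N
      h0win hgp' hgm hg1 hweak
    have T4 := tendsto_setIntegral_chart hRc hRm hR4 hderiv4 hδ hdet4 hDc4 hWc (by positivity) hWnn N
      h4win hgp' hgm hg1 hweak
    simp_rw [he₂, he₀', he₄] at T2 T0 T4
    have := ((T2.sub T0).sub T4).const_mul 2
    simpa using this

end Summit.AtomisticToContinuum.FouriersLaw.Theorems.FGRGap.FoldJetRigidity.EssGap

namespace Summit.AtomisticToContinuum.FouriersLaw.Theorems.FGRGap.FoldJetRigidity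

/-- REGISTERED HELPER STUB `stub_oddEssentialGap_partG` (landing vehicle of this file): the local
coercivity estimate ¼·ofReal(c ∫_{[x₀−ε,x₀+ε]} g² + X g) ≤ q(g) near every base momentum, with X
dying along weakly-null sequences. [folklore] -/
theorem stub_oddEssentialGap_partG :
    ∀ ω₂ : ℝ, 0 < ω₂ → ∀ h : ℝ → ℝ → ℝ,
      (∀ k₁ k₃ : ℝ, resonanceFn ω₂ k₁ (h k₁ k₃) k₃ = 0) →
      (∀ k₁ k₃ : ℝ, h (k₁ + 2 * π) k₃ = h k₁ k₃ ∧ h k₁ (k₃ + 2 * π) = h k₁ k₃) →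
      (∀ k₁ k₃ : ℝ, (∀ n : ℤ, k₃ - k₁ ≠ n * (2 * π)) →
        resonantSet ω₂ k₁ k₃ = {toIocMod Real.two_pi_pos (-π) k₃, h k₁ k₃}) →
      (∀ k₁ k₃ : ℝ, groupVelocity ω₂ k₃ ≠ groupVelocity ω₂ k₁ →
        ∃ (φ : ℝ × ℝ → ℝ) (U : Set (ℝ × ℝ)), U ∈ 𝓝 (k₁, k₃) ∧ AnalyticOnNhd ℝ φ U ∧
          φ (k₁, k₃) = h k₁ k₃ ∧ (∀ p ∈ U, ∃ n : ℤ, φ p = h p.1 p.2 + n * (2 * π)) ∧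
          (∀ p ∈ U, groupVelocity ω₂ p.2 ≠ groupVelocity ω₂ p.1) ∧
          (∀ p ∈ U, HasStrictFDerivAt φ
            (((groupVelocity ω₂ (p.1 + φ p - p.2) - groupVelocity ω₂ p.1) /
                (groupVelocity ω₂ (φ p) - groupVelocity ω₂ (p.1 + φ p - p.2))) •
                ContinuousLinearMap.fst ℝ ℝ ℝ +
              ((groupVelocity ω₂ p.2 - groupVelocity ω₂ (p.1 + φ p - p.2)) /
                (groupVelocity ω₂ (φ p) - groupVelocity ω₂ (p.1 + φ p - p.2))) •
                ContinuousLinearMap.snd ℝ ℝ ℝ) p)) →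
      (∀ k₁ r : ℝ, 0 ≤ r → ∃ k₃ : ℝ,
        (groupVelocity ω₂ k₁ ≠ groupVelocity ω₂ (h k₁ k₃) ∧ groupVelocity ω₂ k₁ ≠ groupVelocity ω₂ k₃ ∧
          groupVelocity ω₂ k₁ ≠ groupVelocity ω₂ (k₁ + h k₁ k₃ - k₃) ∧
            groupVelocity ω₂ (h k₁ k₃) ≠ groupVelocity ω₂ k₃ ∧
          groupVelocity ω₂ (h k₁ k₃) ≠ groupVelocity ω₂ (k₁ + h k₁ k₃ - k₃) ∧
            groupVelocity ω₂ k₃ ≠ groupVelocity ω₂ (k₁ + h k₁ k₃ - k₃)) ∧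
        vertex 1 r k₁ (h k₁ k₃) k₃ ≠ 0) →
      ∀ a b : ℝ, 0 < a → 0 ≤ b → ∀ x₀ : ℝ,
      ∃ ε : ℝ, 0 < ε ∧ ∃ c : ℝ, 0 < c ∧ ∃ X : (ℝ → ℝ) → ℝ,
        (∀ g : ℝ → ℝ, Function.Periodic g (2 * π) → Measurable g → cellNormSq g ≤ 1 →
          ENNReal.ofReal (1 / 4) * ENNReal.ofReal (c * (∫ x in Set.Icc (x₀ - ε) (x₀ + ε), g x ^ 2) + X g) ≤
            boltzmannForm ω₂ a b g) ∧
        (∀ g : ℕ → ℝ → ℝ, (∀ n, Function.Periodic (g n) (2 * π)) → (∀ n, Measurable (g n)) →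
          (∀ n, cellNormSq (g n) ≤ 1) →
          (∀ φ : ℝ → ℝ, Measurable φ → cellNormSq φ < ⊤ →
            Filter.Tendsto (fun n => cellPairing φ (g n)) Filter.atTop (nhds 0)) →
          Filter.Tendsto (fun n => X (g n)) Filter.atTop (nhds 0)) :=
  fun _ω₂ hω _h hres hper htwo hloc hgp _a _b ha hb x₀ =>
    EssGap.local_estimate hω hres hper htwo hloc hgp ha hb x₀

end Summit.AtomisticToContinuum.FouriersLaw.Theorems.FGRGap.FoldJetRigidity

end
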